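import Mathlib
import HarnessLib
import Summits.HubbardSuperconductivity.HubbardSuperconductivity.Theorems.KLProgrammeKLRegimeEngineTowerRemeasureWtAll
import Summits.HubbardSuperconductivity.HubbardSuperconductivity.Theorems.KLProgrammeKLRegimeEngineWtBudget
import Summits.HubbardSuperconductivity.HubbardSuperconductivity.Theorems.KLProgrammeKLRegimeWickCrossContractionSupport

/-!
# K3 ENGINE child `KLRegimeEngineV17F2` (stmt-HubbardSuperconductivity-20437), stub (b) closing path, WEIGHTED track: the SIX-LEG IMPORT BY JUMP RE-SECTORISATION
# in the `KernelNormsWt4` currency — a block input's `klScaleWt`-weighted six-leg pinned sums at a FINER level `J′` from its weighted six-leg CELL at a COARSER level `k`,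
# at the flow frame `K_n`, NO depth window, LOSSLESS against `klWtBudget … 6 = CE³·ε_j²·2^{4j}` (cure (C2) of «(b)-WT4-6LEG-CURRENCY», pen (R416)(B)(1))

Cell gate-hubbard-kl, seat hubbard-kl-k3c2-p3 (g17), row «sector-counting import».  WHY.  Pen (R416): the six-leg IMPORT rows of the W-assembly (W12♯3 ll.156–159,
`… ≤ s₆·(B·ε_j)²` on PLAIN lines) are unfeedable; the cure is to read a block input's six-leg profile at level `j` from its SECTORISED six-leg cell at its own level by jump
re-sectorisation, which at six legs costs exactly the law ratio `16^{j−dk}`.  Every ingredient exists: the window-free weighted jump with one determined leg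
`klWtPinnedSumAt_jump_le_klEng_flow_all (m) (R) (c″)` (…TowerRemeasureWtAll, the (X3) re-key of this lineage's `…TowerRemeasureWt` on p4's window-free overlap constants
`overlapWt_jump_sums_klEng_flow_all`), the rate monotonicity `klWtPinnedSumAt_anti_rate`, and the budget `klWtBudget`.  This file is the six-leg instance in the
W-lane's shape (the `KernelNormsLevels` twin is `…SixLegImportByJump`):

* §1 `klWtBudget_six_eq` (`klWtBudget P Q U j 6 = Q.CE³·ε_j²·2^{4j}`), `klWtBudget_six_mono_jump` (`klWtBudget … k 6 · 16^{J′−k} ≤ klWtBudget … J′ 6` for `k ≤ J′`);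
* §2 **`klWtPinnedSumOf_six_jump_le_klEng_flow_all (R c″)`** — `∃ C₆ʷ > 0` and, given `R.WF2`, count thresholds `c₃′, U₀′ > 0` such that under the binders of
  `klWtPinnedSumAt_jump_le_klEng_flow_all 5 R c″` (`0 < cc ≤ klEngC₃6 P R`, `cc ≤ c₃′`, `μ ∈ klWindowC`, `0 < U ≤ min (klEngU₀3 P R cc) (1/(Gfr₃+1))`, `U ≤ U₀′`, `c″U ≤ 1`,
  `klBetaMin ≤ β ≤ e^{cc/U²}`, `klEngL₃`, `klEngM₃`, `1 ≤ n ≤ nScales β + 1`, `IsKLRegime U cc (−n)`, `HistP klPredsV17F2 … 0 n`, the `FlowPieceOscAt` rows), for every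
  momentum-conserving `T`, every jump `k + 1 ≤ J′ ≤ n` and every bound `N` of the level-`k` six-leg CELL (`∀ q w′, klWtPinnedSumOf … (K_n) k 6 T q w′ ≤ N`):
  `∀ q w, klWtPinnedSumOf … (K_n) J′ 6 T q w ≤ C₆ʷ·16^{J′−k}·N`;
* §3 **`klWtPinnedSumOf_six_jump_le_budget_klEng_flow_all (R c″)`** — the same against the law: if the level-`k` cell is `≤ klWtBudget P Qe U k 6` then every finer level
  `J′ ≤ n` is `≤ C₆ʷ·klWtBudget P Qe U J′ 6` (`0 ≤ Qe.CE`, `P.WF`); and **`klWtPinnedSumOf_six_klTowerInput_jump_le_budget_klEng_flow_all`** — the instance `T = klTowerInput … d k′`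
  (`= 𝒱_{dk′}[K_n]`, momentum-conserving): the W-assembly's six-leg import of block `k′` at every level `J′ ∈ [k+1, n]` from its sectorised six-leg cell at ONE level `k`
  (e.g. `k = dk′`) — no plain line, no `s₆`.
Proofs only (instances + arithmetic); the level-`k` cell stays a hypothesis (E1 / the tower's own m = 6 output); nothing asserts `KernelNormsWt4`, (b), any stub, K3 or
superconductivity.  References: BGM 2006 §2.8 (2.77), (2.82)–(2.84), (2.88)–(2.90), App. A3 [cite: BenfattoGiulianiMastropietro2006].
-/

noncomputable section

namespace Summit.HubbardSuperconductivity.HubbardSuperconductivity.Theorems.EngineV8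

set_option linter.dupNamespace false -- summit = problem name (single-conjunct summit), D-0017

open Classical
open Real Finset Literature.MathematicalPhysics.QuantumLattice Literature.Probability.LatticeModels GrassmannAlgebra
open Summit.HubbardSuperconductivity.HubbardSuperconductivity.Theorems.KLRegimeSplit
open Summit.HubbardSuperconductivity.HubbardSuperconductivity.Theorems.KLProgrammeLegKernels
open Summit.HubbardSuperconductivity.HubbardSuperconductivity.Theorems.DispersionFlow
open Summit.HubbardSuperconductivity.HubbardSuperconductivity.Theorems.KLRegimeWick
open Summit.HubbardSuperconductivity.HubbardSuperconductivity.Theorems.TorusFourierL2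

/-! ## §1 The degree-six budget -/

/-- **The degree-six budget in closed form**: `klWtBudget P Q U j 6 = Q.CE³·ε_j²·2^{4j}`. -/
theorem klWtBudget_six_eq (P : SplitConsts) (Q : EngConsts) (U : ℝ) (j : ℕ) :
    klWtBudget P Q U j 6 = Q.CE ^ 3 * epsCoupling P U j ^ 2 * (2 : ℝ) ^ (4 * j) := by
  rw [klWtBudget_def]
  have h1 : (6 / 2 : ℕ) = 3 := by norm_num
  have h2 : max 1 (6 / 2 - 1 : ℕ) = 2 := by norm_num
  rw [h1, h2]
  have hz : (2 : ℝ) ^ ((3 * ((3 : ℕ) : ℤ) - 5) * (j : ℤ)) = (2 : ℝ) ^ (4 * j) := by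
    rw [show ((3 * ((3 : ℕ) : ℤ) - 5) * (j : ℤ)) = ((4 * j : ℕ) : ℤ) by push_cast; ring, zpow_natCast]
  rw [hz]

/-- **The degree-six budget absorbs the jump factor**: `klWtBudget P Q U k 6 · 16^{J′−k} ≤ klWtBudget P Q U J′ 6` for `k ≤ J′` (`0 ≤ CE`, `0 ≤ Klam`; `ε_k ≤ ε_{J′}`,
`2^{4k}·16^{J′−k} = 2^{4J′}`). [folklore] -/
theorem klWtBudget_six_mono_jump {P : SplitConsts} (hK : 0 ≤ P.Klam) {Q : EngConsts} (hCE : 0 ≤ Q.CE) (U : ℝ) {k J' : ℕ} (hkJ : k ≤ J') :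
    klWtBudget P Q U k 6 * (16 : ℝ) ^ (J' - k) ≤ klWtBudget P Q U J' 6 := by
  rw [klWtBudget_six_eq, klWtBudget_six_eq]
  have hε0 : 0 ≤ epsCoupling P U k := by
    rw [epsCoupling]; exact mul_nonneg hK (by positivity)
  have hεle : epsCoupling P U k ≤ epsCoupling P U J' := by
    rw [epsCoupling, epsCoupling]
    refine mul_le_mul_of_nonneg_left ?_ hK
    have : (k : ℝ) ≤ J' := by exact_mod_cast hkJ
    nlinarith [sq_nonneg U, abs_nonneg U]
  have hpow : (2 : ℝ) ^ (4 * k) * (16 : ℝ) ^ (J' - k) = (2 : ℝ) ^ (4 * J') := by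
    rw [show (16 : ℝ) = 2 ^ 4 by norm_num, ← pow_mul, ← pow_add]
    congr 1
    omega
  calc Q.CE ^ 3 * epsCoupling P U k ^ 2 * (2 : ℝ) ^ (4 * k) * (16 : ℝ) ^ (J' - k)
      = Q.CE ^ 3 * epsCoupling P U k ^ 2 * ((2 : ℝ) ^ (4 * k) * (16 : ℝ) ^ (J' - k)) := by ring
    _ = Q.CE ^ 3 * epsCoupling P U k ^ 2 * (2 : ℝ) ^ (4 * J') := by rw [hpow]
    _ ≤ Q.CE ^ 3 * epsCoupling P U J' ^ 2 * (2 : ℝ) ^ (4 * J') := by gcongr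

/-! ## §2 The weighted six-leg jump at the flow frame, no window -/

/-- **THE WEIGHTED SIX-LEG IMPORT BY JUMP RE-SECTORISATION AT THE FLOW FRAME, NO DEPTH WINDOW** (instance `m + 1 = 6` of `klWtPinnedSumAt_jump_le_klEng_flow_all`, rate tied to
the fine level): `∃ C₆ʷ > 0` and, given `R.WF2`, thresholds `c₃′, U₀′ > 0` such that under the binders listed in the module docstring, for every momentum-conserving `T`, every
jump `k + 1 ≤ J′ ≤ n` and every bound `N ≥ 0` of the level-`k` six-leg weighted CELL of `T` (`∀ q w′, klWtPinnedSumOf … (K_n) k 6 T q w′ ≤ N`):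
`∀ q w, klWtPinnedSumOf L M β μ (K_n) J′ 6 T q w ≤ C₆ʷ·16^{J′−k}·N`. [cite: BenfattoGiulianiMastropietro2006, §2.8 (2.82)-(2.84), (2.88)-(2.90)] -/
theorem klWtPinnedSumOf_six_jump_le_klEng_flow_all (R : RenConsts) (c'' : ℝ) (hc'' : 0 ≤ c'') :
    ∃ C : ℝ, 0 < C ∧ (R.WF2 → ∃ c₃' : ℝ, 0 < c₃' ∧ ∃ U₀' : ℝ, 0 < U₀' ∧
      ∀ (G : GeoConsts) (P : SplitConsts) (Q : EngConsts) (cc : ℝ), 0 < cc → cc ≤ klEngC₃6 P R → cc ≤ c₃' →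
      ∀ μ ∈ klWindowC, ∀ U : ℝ, 0 < U → U ≤ min (klEngU₀3 P R cc) (1 / (R.Gfr 3 + 1)) → U ≤ U₀' → c'' * U ≤ 1 →
      ∀ β : ℝ, klBetaMin ≤ β → β ≤ Real.exp (cc / U ^ 2) →
      ∀ (L M : ℕ) [NeZero L] [NeZero M], klEngL₃ β U ≤ L → klEngM₃ β U L ≤ M →
      ∀ n : ℕ, 1 ≤ n → n ≤ nScales β + 1 → IsKLRegime U cc (-(n : ℤ)) → HistP klPredsV17F2 L M G P Q R β U μ 0 n →
        (∀ m', 1 ≤ m' → m' < n → FlowPieceOscAt L M c'' β U μ m') →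
        ∀ k J' : ℕ, k + 1 ≤ J' → J' ≤ n →
        ∀ T : HubbardGrassmann L M,
          (∀ (m' : ℕ) (X : Fin m' → HubbardFieldIdx L M), ∑ i, signedMomentum L (X i).2 (X i).1.1.2 ≠ 0 → kernel ℂ T m' X = 0) →
        ∀ N : ℝ, 0 ≤ N →
          (∀ (q : Fin 6) (w' : SpaceTimeIdx L M × SectorLeg (sectorCount k)), klWtPinnedSumOf L M β μ (klFlowFrameU L M β U μ n) k 6 T q w' ≤ N) →
          ∀ (q : Fin 6) (w : SpaceTimeIdx L M × SectorLeg (sectorCount J')),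
            klWtPinnedSumOf L M β μ (klFlowFrameU L M β U μ n) J' 6 T q w ≤ C * (16 : ℝ) ^ (J' - k) * N) := by
  obtain ⟨C, hC, h⟩ := klWtPinnedSumAt_jump_le_klEng_flow_all 5 R c'' hc''
  refine ⟨C, hC, fun hR2 => ?_⟩
  obtain ⟨c₃', hc₃', U₀', hU₀', h'⟩ := h hR2
  refine ⟨c₃', hc₃', U₀', hU₀', ?_⟩
  intro G P Q cc hcc hcc6 hcc₃' μ hμ U hU hUle hU₀' hcU β hβmin hβc L M _ _ hL3 hM3 n hn1 hnN hkl hhist hosc k J' hJ hJn T hT N hN0 hN q w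
  have hβ0 : 0 ≤ β := (pos_of_klBetaMin_le hβmin).le
  have hkJ : k ≤ J' := by omega
  -- the coarse carriers at the FINE rate `J′` are dominated by the tied (rate-`k`) cell
  have hN' : ∀ w' : SpaceTimeIdx L M × SectorLeg (sectorCount k),
      klWtPinnedSumAt L M β μ (klFlowFrameU L M β U μ n) k J' 6 T q w' ≤ N := fun w' =>
    (klWtPinnedSumAt_le_klWtPinnedSumOf hβ0 μ _ hkJ 6 T q w').trans (hN q w')
  have hstep := h' G P Q cc hcc hcc6 hcc₃' μ hμ U hU hUle hU₀' hcU β hβmin hβc L M hL3 hM3 n hn1 hnN hkl hhist hosc k J' hJ hJn T hT J' le_rfl q w N hN0 hN'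
  rw [klWtPinnedSumAt_self] at hstep
  have h16 : ((2 : ℝ) ^ (J' - k)) ^ (5 - 1) = (16 : ℝ) ^ (J' - k) := by
    rw [show (5 - 1 : ℕ) = 4 from rfl, ← pow_mul, mul_comm, pow_mul]; norm_num
  rw [h16] at hstep
  exact hstep

/-! ## §3 Against the law, and the block-input instance -/

/-- **THE WEIGHTED SIX-LEG CELL AT ONE LEVEL GIVES `C₆ʷ ×` THE SIX-LEG LAW AT EVERY FINER LEVEL** (no window): with `C₆ʷ`, `c₃′`, `U₀′` of
`klWtPinnedSumOf_six_jump_le_klEng_flow_all`, under the same binders plus `P.WF`, `0 ≤ Qe.CE`: if a momentum-conserving `T` meets the degree-6 law at level `k`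
(`∀ q w′, klWtPinnedSumOf … (K_n) k 6 T q w′ ≤ klWtBudget P Qe U k 6`), then at every `k + 1 ≤ J′ ≤ n`:
`∀ q w, klWtPinnedSumOf … (K_n) J′ 6 T q w ≤ C₆ʷ·klWtBudget P Qe U J′ 6`. [cite: BenfattoGiulianiMastropietro2006, §2.8 (2.77), (2.82)-(2.84)] -/
theorem klWtPinnedSumOf_six_jump_le_budget_klEng_flow_all (R : RenConsts) (c'' : ℝ) (hc'' : 0 ≤ c'') :
    ∃ C : ℝ, 0 < C ∧ (R.WF2 → ∃ c₃' : ℝ, 0 < c₃' ∧ ∃ U₀' : ℝ, 0 < U₀' ∧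
      ∀ (G : GeoConsts) (P : SplitConsts) (Q : EngConsts) (cc : ℝ), P.WF → 0 < cc → cc ≤ klEngC₃6 P R → cc ≤ c₃' →
      ∀ μ ∈ klWindowC, ∀ U : ℝ, 0 < U → U ≤ min (klEngU₀3 P R cc) (1 / (R.Gfr 3 + 1)) → U ≤ U₀' → c'' * U ≤ 1 →
      ∀ β : ℝ, klBetaMin ≤ β → β ≤ Real.exp (cc / U ^ 2) →
      ∀ (L M : ℕ) [NeZero L] [NeZero M], klEngL₃ β U ≤ L → klEngM₃ β U L ≤ M →
      ∀ n : ℕ, 1 ≤ n → n ≤ nScales β + 1 → IsKLRegime U cc (-(n : ℤ)) → HistP klPredsV17F2 L M G P Q R β U μ 0 n →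
        (∀ m', 1 ≤ m' → m' < n → FlowPieceOscAt L M c'' β U μ m') →
        ∀ (Qe : EngConsts), 0 ≤ Qe.CE → ∀ k J' : ℕ, k + 1 ≤ J' → J' ≤ n →
        ∀ T : HubbardGrassmann L M,
          (∀ (m' : ℕ) (X : Fin m' → HubbardFieldIdx L M), ∑ i, signedMomentum L (X i).2 (X i).1.1.2 ≠ 0 → kernel ℂ T m' X = 0) →
          (∀ (q : Fin 6) (w' : SpaceTimeIdx L M × SectorLeg (sectorCount k)),
            klWtPinnedSumOf L M β μ (klFlowFrameU L M β U μ n) k 6 T q w' ≤ klWtBudget P Qe U k 6) →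
          ∀ (q : Fin 6) (w : SpaceTimeIdx L M × SectorLeg (sectorCount J')),
            klWtPinnedSumOf L M β μ (klFlowFrameU L M β U μ n) J' 6 T q w ≤ C * klWtBudget P Qe U J' 6) := by
  obtain ⟨C, hC, h⟩ := klWtPinnedSumOf_six_jump_le_klEng_flow_all R c'' hc''
  refine ⟨C, hC, fun hR2 => ?_⟩
  obtain ⟨c₃', hc₃', U₀', hU₀', h'⟩ := h hR2
  refine ⟨c₃', hc₃', U₀', hU₀', ?_⟩
  intro G P Q cc hP hcc hcc6 hcc₃' μ hμ U hU hUle hU₀' hcU β hβmin hβc L M _ _ hL3 hM3 n hn1 hnN hkl hhist hosc Qe hCE k J' hJ hJn T hT hcell q w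
  have hK : 0 ≤ P.Klam := zero_le_one.trans hP.1
  have hB0 : 0 ≤ klWtBudget P Qe U k 6 := klWtBudget_nonneg hCE hK U k 6
  have hstep := h' G P Q cc hcc hcc6 hcc₃' μ hμ U hU hUle hU₀' hcU β hβmin hβc L M hL3 hM3 n hn1 hnN hkl hhist hosc k J' hJ hJn T hT _ hB0 hcell q w
  have hlaw := klWtBudget_six_mono_jump hK hCE U (show k ≤ J' by omega)
  calc klWtPinnedSumOf L M β μ (klFlowFrameU L M β U μ n) J' 6 T q w ≤ C * (16 : ℝ) ^ (J' - k) * klWtBudget P Qe U k 6 := hstep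
    _ = C * (klWtBudget P Qe U k 6 * (16 : ℝ) ^ (J' - k)) := by ring
    _ ≤ C * klWtBudget P Qe U J' 6 := mul_le_mul_of_nonneg_left hlaw hC.le

/-- **THE W-ASSEMBLY'S SIX-LEG IMPORT OF A BLOCK INPUT FROM ITS SECTORISED CELL AT ONE LEVEL** (instance `T = klTowerInput L M β U μ (K_n) d k′ = 𝒱_{dk′}[K_n]`, which conserves
momentum): with `C₆ʷ`, `c₃′`, `U₀′` of `klWtPinnedSumOf_six_jump_le_klEng_flow_all`, under the same binders plus `P.WF`, `0 ≤ Qe.CE`: if the block input meets the degree-6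
law at ONE level `k` (`∀ q w′, klWtPinnedSumOf … (K_n) k 6 (𝒱_{dk′}[K_n]) q w′ ≤ klWtBudget P Qe U k 6`) then at every level `k + 1 ≤ J′ ≤ n`
`∀ q w, klWtPinnedSumOf … (K_n) J′ 6 (𝒱_{dk′}[K_n]) q w ≤ C₆ʷ·klWtBudget P Qe U J′ 6` — replacing the plain-line import `s₆·(B·ε_j)²` of W12♯3 ll.156–159.
[cite: BenfattoGiulianiMastropietro2006, §2.8 (2.77), (2.82)-(2.84)] -/
theorem klWtPinnedSumOf_six_klTowerInput_jump_le_budget_klEng_flow_all (R : RenConsts) (c'' : ℝ) (hc'' : 0 ≤ c'') :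
    ∃ C : ℝ, 0 < C ∧ (R.WF2 → ∃ c₃' : ℝ, 0 < c₃' ∧ ∃ U₀' : ℝ, 0 < U₀' ∧
      ∀ (G : GeoConsts) (P : SplitConsts) (Q : EngConsts) (cc : ℝ), P.WF → 0 < cc → cc ≤ klEngC₃6 P R → cc ≤ c₃' →
      ∀ μ ∈ klWindowC, ∀ U : ℝ, 0 < U → U ≤ min (klEngU₀3 P R cc) (1 / (R.Gfr 3 + 1)) → U ≤ U₀' → c'' * U ≤ 1 →
      ∀ β : ℝ, klBetaMin ≤ β → β ≤ Real.exp (cc / U ^ 2) →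
      ∀ (L M : ℕ) [NeZero L] [NeZero M], klEngL₃ β U ≤ L → klEngM₃ β U L ≤ M →
      ∀ n : ℕ, 1 ≤ n → n ≤ nScales β + 1 → IsKLRegime U cc (-(n : ℤ)) → HistP klPredsV17F2 L M G P Q R β U μ 0 n →
        (∀ m', 1 ≤ m' → m' < n → FlowPieceOscAt L M c'' β U μ m') →
        ∀ (Qe : EngConsts), 0 ≤ Qe.CE → ∀ (d k' k J' : ℕ), k + 1 ≤ J' → J' ≤ n →
          (∀ (q : Fin 6) (w' : SpaceTimeIdx L M × SectorLeg (sectorCount k)),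
            klWtPinnedSumOf L M β μ (klFlowFrameU L M β U μ n) k 6 (klTowerInput L M β U μ (klFlowFrameU L M β U μ n) d k') q w' ≤ klWtBudget P Qe U k 6) →
          ∀ (q : Fin 6) (w : SpaceTimeIdx L M × SectorLeg (sectorCount J')),
            klWtPinnedSumOf L M β μ (klFlowFrameU L M β U μ n) J' 6 (klTowerInput L M β U μ (klFlowFrameU L M β U μ n) d k') q w ≤
              C * klWtBudget P Qe U J' 6) := by
  obtain ⟨C, hC, h⟩ := klWtPinnedSumOf_six_jump_le_budget_klEng_flow_all R c'' hc''
  refine ⟨C, hC, fun hR2 => ?_⟩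
  obtain ⟨c₃', hc₃', U₀', hU₀', h'⟩ := h hR2
  refine ⟨c₃', hc₃', U₀', hU₀', ?_⟩
  intro G P Q cc hP hcc hcc6 hcc₃' μ hμ U hU hUle hU₀' hcU β hβmin hβc L M _ _ hL3 hM3 n hn1 hnN hkl hhist hosc Qe hCE d k' k J' hJ hJn hcell q w
  exact h' G P Q cc hP hcc hcc6 hcc₃' μ hμ U hU hUle hU₀' hcU β hβmin hβc L M hL3 hM3 n hn1 hnN hkl hhist hosc Qe hCE k J' hJ hJn
    (klTowerInput L M β U μ (klFlowFrameU L M β U μ n) d k')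
    (fun m' X hX => by unfold klTowerInput; exact klEffectiveAction_momentumConserving β U μ _ klE0 (d * k') m' X hX) hcell q w

end Summit.HubbardSuperconductivity.HubbardSuperconductivity.Theorems.EngineV8

end
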